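import Summits.QuantumFields.BalabanUV.Beta.RemainderExplicitHistoryDiagonalBoundedMemoryRate
import Summits.QuantumFields.BalabanUV.Beta.RemainderExplicitHistoryDiagonalComparison

/-!
# RemainderExplicitHistoryDiagonalBoundedMemoryLower — ROAD P3, ORDER-0 PROFILE FAMILY: THE LOWER WINDOW LAW FOR A BOUNDED MEMORY — the third
# file's window closed form read FROM BELOW: for two infrared-pinned runs with a profile supported on the ages `≤ A` and a position at least one
# memory length away from both the memory edge and the pin, `(1 + M₁γ³∕(2(1−Wγ∕b)))·d_j ≥ Σ_{a≤A} ρ(a)·Σ_{i∈[j−a,j)} (g^A_i∕8)·min(1, d_i(g^A_i)²)`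
# (the pin window costs at most `M₁(γ³∕2)·max_{[K−A,K)} d ≤ M₁(γ³∕2)·d_j∕(1−Wγ∕b)` by generation 50's comparison), and for a pinned family the
# continuum discrepancy obeys the LOWER RENEWAL INEQUALITY `(1 + M₁γ³∕(2(1−Wγ∕b)))·(astar g m − invSq g m n) ≥ Σ_{a≤A} ρ(a)·Σ_{i∈[n−a,n)}
# ((g^{n+m}_i)³∕8)·(astar g (n+m−i) − invSq g (n+m−i) i)` — with the third file's upper contraction the two-sided block structure
# `d_j ≍ Σ_{s≤A} ρ̄(s)·(g³)·d_{j−s}` of the bounded-memory class (station S-d4p3-g53-1, fifth file; imports the third file and generation 50's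
# `…Comparison`)

Cell `pub-balaban`, β-function sub-cell, BINDER row D4 «RemainderConst leaves for Bałaban's split» (`HOME/BINDER-OWNERS.md`; owner lineage
`b2b-balaban-beta-an4`; this file by co-owner #3 lineage `b2b-balaban-beta-d4-p3`, road P3 «the reduction road», generation 53, station
S-d4p3-g53-1, fifth file), β-FLOW TEAM duty (1); FREEZE (0) honoured (def-free module in road P3's own `RemainderExplicit*` series; no leaf, no
interface, no Literature file).  SOURCE OF THE SHAPES ONLY: [Balaban1987RG1] (0.20) p. 256, (0.31) and Thm 2 p. 259, §5 p. 298.  [folklore] real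
analysis about ONE explicit toy family (ours).  HONEST FRAMING: *"Discharging BetaPertH makes Bałaban's UV stability UNCONDITIONAL — a real
constructive-QFT result; it is NOT the continuum limit and NOT the Clay problem."*  THIS FILE DISCHARGES NOTHING OF THE KIND; nothing of Bałaban's
(1.22) is asserted or constructed; row D4 class UNCHANGED (critical-path width 0; instance 0∕1; D4 DISCHARGE NO DATE); NOT B12 Thm 2, NOT
BetaPertH, NOT continuum, NOT Clay.  HONEST DEPENDENCY: continuum YM on T⁴ ⇐ BetaPertH ∧ nine spine estimates (0/9 proved); BetaPertH ⇐ (D1) ∧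
(D4) ∧ CAP+tail; G-an2-4 gates asym, D1 and NE2/3/4.  ABSOLUTE RULE: nothing is cited as a fact.  All letters NOT-IN-PRINT; `BetaFlowAsPrinted S`
records a Markov β_n only.

WHY.  The third file turned its window closed form `d_j = Φ(j) − Φ(K)`, `Φ(l) = Σ_{a≤A} ρ(a)Σ_{i∈[l−a,l)} e_i`, into an UPPER contraction by dropping
`Φ(K) ≥ 0` and converting `e ≤ (g³∕2)d`.  From BELOW one converts `e_i ≥ (g_i∕8)·min(1, d_i g_i²)` (generation 48's `mul_min_le_gap`) and must PAY for
the pin window `Φ(K)`: its gaps sit at positions `≥ K − A ≥ j`, where generation 50's comparison `d_i ≤ d_j∕(1 − Wγ∕b)` (`…Comparison.disc_le_disc_div`,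
`Wγ < b`) and `e_i ≤ (γ³∕2)d_i` bound it by `M₁(γ³∕2)d_j∕(1 − Wγ∕b)`, which moves to the left side (§1).  For a pinned family (§2) the `min` resolves
(`d_i·g_i² ≤ Wγ∕b < 1` at every infrared distance `≥ 1`, from generation 47's affine ceiling and logarithmic floor of the recursion variable), and
`N → ∞` in the pair inequality gives the lower renewal inequality of the title: the continuum discrepancy at `(m, n)` is at least the
`ρ`-window sum of `(g³∕8)` times the discrepancies ONE WINDOW EARLIER (larger infrared distance, smaller cutoff) — the mirror image of the third
file's `disc_le_firstMoment_mul`, constants `1∕8` vs `1∕2` and the pin factor apart.  (An induction over blocks from below loses one factor per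
POSITION, not per block — the staircase of the seat numerics `HOME/b2b-balaban-beta-d4-p3/g53/numerics/hp_tight5.out` (within-block spread ≈ ×20
for A = 5) is real — so no closed lower RATE is claimed here.)

WHAT IS PROVED ([folklore]; 0 sorry; 0 `def`; profile `ρ ≥ 0` with `ρ(a) = 0` for `a > A`; `M₁ = Σ_{a≤A} a·ρ(a)`; `b > 0`, `γ > 0`, `Σ_{a<N}ρ(a) ≤ W`, `Wγ < b`).
* §1 TWO PINNED RUNS (A: `K` steps in ]0,γ], B: `K + n` steps, pinned): `pinWindow_le` (`A ≤ j`, `j + A ≤ K` ⇒ `Σ_{a≤A} ρ(a)Σ_{i∈[K−a,K)} e_i ≤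
  M₁(γ³∕2)·d_j∕(1−Wγ∕b)`), **`disc_ge_windowSum_min`** (`(1 + M₁γ³∕(2(1−Wγ∕b)))·d_j ≥ Σ_{a≤A} ρ(a)Σ_{i∈[j−a,j)} (g^A_i∕8)·min(1, d_i(g^A_i)²)`).
* §2 PINNED FAMILY (`g K` the run with `K` steps, `g K K = g_IR`): `shiftDisc_mul_sq_le` (`(invSq g m′ (n′+N) − invSq g m′ n′)·(g (n′+m′) n′)² ≤ Wγ∕b`
  for `m′ ≥ 1`), **`astar_sub_invSq_lower_window`** (`m ≥ A`, `n ≥ A` ⇒ the lower renewal inequality of the title).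
-/

noncomputable section

open Finset Filter Topology

namespace Summit.QuantumFields.BalabanUV.Beta.RemainderExplicitHistoryDiagonalBoundedMemoryLower

open Literature.MathematicalPhysics.QuantumFieldTheory.Balaban1983to89
open Literature.MathematicalPhysics.QuantumFieldTheory.Balaban1983to89.FlowStep
open Literature.MathematicalPhysics.QuantumFieldTheory.Balaban1983to89.T4CouplingMatching
open Literature.MathematicalPhysics.QuantumFieldTheory.Balaban1983to89.T4ContinuumCoupling
open Summit.QuantumFields.BalabanUV.Beta.RemainderExplicitHistoryDiagonalMonotone
open Summit.QuantumFields.BalabanUV.Beta.RemainderExplicitHistoryDiagonalWeights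
open Summit.QuantumFields.BalabanUV.Beta.RemainderExplicitHistoryDiagonalTwoRun
open Summit.QuantumFields.BalabanUV.Beta.RemainderExplicitHistoryDiagonalWindow
open Summit.QuantumFields.BalabanUV.Beta.RemainderExplicitHistoryDiagonalComparison
open Summit.QuantumFields.BalabanUV.Beta.RemainderExplicitHistoryDiagonalBoundedMemoryRate

variable {β : HBeta} {b γ W : ℝ} {ρ : ℕ → ℝ}

/-! ## §1 Two pinned runs: the pin window and the lower window law -/

/-- **THE PIN WINDOW IS CHEAP.**  Profile supported on the ages `≤ A` (`ρ ≥ 0`, `Σ_{a<N} ρ(a) ≤ W`, `b > 0`, `γ > 0`, `Wγ < b`); two runs (A: `K` steps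
in ]0,γ], B: `K + n` steps, positive couplings) pinned `g^A_K = g^B_{K+n}`; a position `j` with `j + A ≤ K`.  THEN
`Σ_{a≤A} ρ(a)·Σ_{i∈[K−a,K)} (g^A_i − g^B_{i+n}) ≤ (Σ_{a≤A} a·ρ(a))·(γ³∕2)·d_j∕(1 − Wγ∕b)` — every gap of the pin window sits at a position `i ≥ j`,
where `e_i ≤ ((g^A_i)³∕2)·d_i ≤ (γ³∕2)·d_j∕(1 − Wγ∕b)` (g47's `gap_le_cube_mul`, g50's `disc_le_disc_div`). [cite: Balaban1987RG1, (0.20) p.256 and Thm 2 p.259] -/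
theorem pinWindow_le
    (hβ : ∀ (k : ℕ) (p : Fin (k + 1) → ℝ),
      β k p = b + ∑ i : Fin (k + 1), ρ (k - i) * min (p (Fin.last k)) (|p (Fin.last k) - p i|))
    (hb : 0 < b) (hγ : 0 < γ) (hρ0 : ∀ a, 0 ≤ ρ a) (hρW : ∀ n, ∑ a ∈ range n, ρ a ≤ W) (hsmall : W * γ < b) {A K n : ℕ}
    {gA gB : ℕ → ℝ} (hA : RGEqH K β gA) (hB : RGEqH (K + n) β gB) (hAbox : ∀ k, k ≤ K → 0 < gA k ∧ gA k ≤ γ)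
    (hBpos : ∀ k, k ≤ K + n → 0 < gB k) (hpin : gA K = gB (K + n)) {j : ℕ} (hjK : j + A ≤ K) :
    ∑ a ∈ range (A + 1), ρ a * ∑ i ∈ Ico (K - a) K, (gA i - gB (i + n))
      ≤ (∑ a ∈ range (A + 1), ρ a * a) * (γ ^ 3 / 2)
          * ((1 / (gB (j + n)) ^ 2 - 1 / (gA j) ^ 2) / (1 - W * γ / b)) := by
  have hApos : ∀ k, k ≤ K → 0 < gA k := fun k hk => (hAbox k hk).1
  have hdom := invSq_le_invSq_shift_run hβ hb hρ0 hA hB hApos hBpos hpin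
  set D : ℝ := (1 / (gB (j + n)) ^ 2 - 1 / (gA j) ^ 2) / (1 - W * γ / b) with hD
  -- each gap of the pin window is `≤ (γ³∕2)·D`
  have hterm : ∀ a ∈ range (A + 1), ∀ i ∈ Ico (K - a) K, gA i - gB (i + n) ≤ γ ^ 3 / 2 * D := by
    intro a ha i hi
    have haA : a ≤ A := by have := Finset.mem_range.mp ha; omega
    have hi1 := (Finset.mem_Ico.mp hi).1
    have hi2 := (Finset.mem_Ico.mp hi).2
    have hdi : 0 ≤ 1 / (gB (i + n)) ^ 2 - 1 / (gA i) ^ 2 := by linarith [hdom i hi2.le]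
    have hBA : gB (i + n) ≤ gA i := le_of_one_div_sq_le (hApos i hi2.le) (hBpos (i + n) (by omega)) (hdom i hi2.le)
    have h1 := gap_le_cube_mul (hBpos (i + n) (by omega)) hBA
    have hcube : (gA i) ^ 3 ≤ γ ^ 3 := pow_le_pow_left₀ (hApos i hi2.le).le (hAbox i hi2.le).2 3
    have hcmp := disc_le_disc_div hβ hb hγ hρ0 hρW hsmall hA hB hAbox hBpos hpin (j := j) (j' := i) (by omega) hi2.le
    have hDi : 1 / (gB (i + n)) ^ 2 - 1 / (gA i) ^ 2 ≤ D := by rw [hD]; exact hcmp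
    calc gA i - gB (i + n) ≤ (gA i) ^ 3 / 2 * (1 / (gB (i + n)) ^ 2 - 1 / (gA i) ^ 2) := h1
      _ ≤ γ ^ 3 / 2 * (1 / (gB (i + n)) ^ 2 - 1 / (gA i) ^ 2) := by nlinarith
      _ ≤ γ ^ 3 / 2 * D := by nlinarith [pow_pos hγ 3]
  calc ∑ a ∈ range (A + 1), ρ a * ∑ i ∈ Ico (K - a) K, (gA i - gB (i + n))
      ≤ ∑ a ∈ range (A + 1), ρ a * ((a : ℝ) * (γ ^ 3 / 2 * D)) := by
        refine Finset.sum_le_sum fun a ha => mul_le_mul_of_nonneg_left ?_ (hρ0 a)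
        have haA : a ≤ A := by have := Finset.mem_range.mp ha; omega
        have h := Finset.sum_le_sum (hterm a ha)
        rw [Finset.sum_const, Nat.card_Ico, show K - (K - a) = a by omega, nsmul_eq_mul] at h
        exact h
    _ = (∑ a ∈ range (A + 1), ρ a * a) * (γ ^ 3 / 2) * D := by rw [Finset.sum_mul, Finset.sum_mul]; exact Finset.sum_congr rfl fun a _ => by ring

/-- **THE LOWER WINDOW LAW.**  Same runs; a position with `A ≤ j` and `j + A ≤ K`.  THEN
`(1 + (Σ_{a≤A} a·ρ(a))·γ³∕(2(1 − Wγ∕b)))·d_j ≥ Σ_{a≤A} ρ(a)·Σ_{i∈[j−a,j)} (g^A_i∕8)·min(1, d_i·(g^A_i)²)` — the third file's closed form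
`d_j = Φ(j) − Φ(K)`, generation 48's `mul_min_le_gap` for every gap of the window of `j`, and `pinWindow_le` for `Φ(K)`. [cite: Balaban1987RG1, (0.20) p.256 and Thm 2 p.259] -/
theorem disc_ge_windowSum_min
    (hβ : ∀ (k : ℕ) (p : Fin (k + 1) → ℝ),
      β k p = b + ∑ i : Fin (k + 1), ρ (k - i) * min (p (Fin.last k)) (|p (Fin.last k) - p i|))
    (hb : 0 < b) (hγ : 0 < γ) (hρ0 : ∀ a, 0 ≤ ρ a) (hρW : ∀ n, ∑ a ∈ range n, ρ a ≤ W) (hsmall : W * γ < b) {A : ℕ}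
    (hρA : ∀ a, A < a → ρ a = 0) {K n : ℕ} {gA gB : ℕ → ℝ} (hA : RGEqH K β gA) (hB : RGEqH (K + n) β gB)
    (hAbox : ∀ k, k ≤ K → 0 < gA k ∧ gA k ≤ γ) (hBpos : ∀ k, k ≤ K + n → 0 < gB k) (hpin : gA K = gB (K + n)) {j : ℕ}
    (hAj : A ≤ j) (hjK : j + A ≤ K) :
    ∑ a ∈ range (A + 1), ρ a * ∑ i ∈ Ico (j - a) j,
        (gA i / 8 * min 1 ((1 / (gB (i + n)) ^ 2 - 1 / (gA i) ^ 2) * (gA i) ^ 2))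
      ≤ (1 + (∑ a ∈ range (A + 1), ρ a * a) * γ ^ 3 / (2 * (1 - W * γ / b)))
          * (1 / (gB (j + n)) ^ 2 - 1 / (gA j) ^ 2) := by
  have hApos : ∀ k, k ≤ K → 0 < gA k := fun k hk => (hAbox k hk).1
  have hdom := invSq_le_invSq_shift_run hβ hb hρ0 hA hB hApos hBpos hpin
  have hc : 0 < 1 - W * γ / b := by
    have : W * γ / b < 1 := (div_lt_one hb).mpr hsmall
    linarith
  have hclosed := disc_eq_windowSum_sub hβ hb hρ0 hρA hA hB hApos hBpos hpin hAj (by omega : j ≤ K)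
  have hpinW := pinWindow_le hβ hb hγ hρ0 hρW hsmall hA hB hAbox hBpos hpin hjK
  -- the window of `j` from below, gap by gap
  have hlow : ∑ a ∈ range (A + 1), ρ a * ∑ i ∈ Ico (j - a) j,
        (gA i / 8 * min 1 ((1 / (gB (i + n)) ^ 2 - 1 / (gA i) ^ 2) * (gA i) ^ 2))
      ≤ ∑ a ∈ range (A + 1), ρ a * ∑ i ∈ Ico (j - a) j, (gA i - gB (i + n)) := by
    refine Finset.sum_le_sum fun a _ => mul_le_mul_of_nonneg_left (Finset.sum_le_sum fun i hi => ?_) (hρ0 a)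
    have hi2 : i < j := (Finset.mem_Ico.mp hi).2
    have hiK : i ≤ K := by omega
    refine mul_min_le_gap (hBpos (i + n) (by omega)) (hApos i hiK) ?_ ?_
    · linarith [hdom i hiK]
    · linarith
  -- assemble: `Φ(j) = d_j + Φ(K) ≤ d_j + M₁(γ³∕2)·d_j∕(1−Wγ∕b)`
  set d : ℝ := 1 / (gB (j + n)) ^ 2 - 1 / (gA j) ^ 2 with hd
  have hsplit : ∑ a ∈ range (A + 1), ρ a * ∑ i ∈ Ico (j - a) j, (gA i - gB (i + n))
      = d + ∑ a ∈ range (A + 1), ρ a * ∑ i ∈ Ico (K - a) K, (gA i - gB (i + n)) := by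
    rw [hclosed, ← Finset.sum_add_distrib]
    exact Finset.sum_congr rfl fun a _ => by ring
  have hcne : 1 - W * γ / b ≠ 0 := hc.ne'
  have e1 : (1 + (∑ a ∈ range (A + 1), ρ a * a) * γ ^ 3 / (2 * (1 - W * γ / b))) * d
      = d + (∑ a ∈ range (A + 1), ρ a * a) * (γ ^ 3 / 2) * (d / (1 - W * γ / b)) := by
    set q : ℝ := 1 - W * γ / b with hq
    have hqne : q ≠ 0 := hcne
    field_simp
  rw [e1]
  linarith [hlow, hsplit, hpinW]

/-! ## §2 Pinned family: the lower renewal inequality -/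

/-- ALONG A PINNED FAMILY THE MATCHED DISCREPANCY IS SMALL AGAINST THE COUPLING: for every infrared distance `m′ ≥ 1` and cutoffs `n′, N`:
`(invSq g m′ (n′+N) − invSq g m′ n′)·(g (n′+m′) n′)² ≤ Wγ∕b` — the recursion variable is at most `1∕g_IR² + m′(b + Wγ)` (g47's `invSq_le_affine`)
and at least `1∕g_IR² + b·m′ ≥ b·m′` (g47's `prof_le_invSq_orderZero`). [folklore] -/
theorem shiftDisc_mul_sq_le
    (hβ : ∀ (k : ℕ) (p : Fin (k + 1) → ℝ),
      β k p = b + ∑ i : Fin (k + 1), ρ (k - i) * min (p (Fin.last k)) (|p (Fin.last k) - p i|))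
    (hb : 0 < b) (hρ0 : ∀ a, 0 ≤ ρ a) (hρW : ∀ n, ∑ a ∈ range n, ρ a ≤ W) {g : ℕ → ℕ → ℝ} {gIR : ℝ}
    (hrun : ∀ K, RGEqH K β (g K)) (hbox : ∀ K i, i ≤ K → 0 < g K i ∧ g K i ≤ γ) (hpin : ∀ K, g K K = gIR) {m' : ℕ}
    (hm' : 1 ≤ m') (n' N : ℕ) :
    (invSq g m' (n' + N) - invSq g m' n') * (g (n' + m') n') ^ 2 ≤ W * γ / b := by
  have hW : 0 ≤ W := by simpa using hρW 0
  have hγ : 0 < γ := lt_of_lt_of_le (hbox 0 0 le_rfl).1 (hbox 0 0 le_rfl).2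
  set x : ℝ := g (n' + m') n' with hx
  have hxpos : 0 < x := (hbox _ n' (by omega)).1
  have hup := invSq_le_affine hβ hρ0 hρW hrun hbox hpin m' (n' + N)
  have hlo := prof_le_invSq_orderZero hβ hρ0 hrun hbox hpin m' n'
  have hinv : invSq g m' n' = 1 / x ^ 2 := by rw [invSq_def, hx]
  -- the discrepancy is `≤ m′·Wγ`, the square of the coupling `≤ 1∕(b m′)`
  have hdiff : invSq g m' (n' + N) - invSq g m' n' ≤ (m' : ℝ) * (W * γ) := by nlinarith
  have hm'pos : (0 : ℝ) < m' := by exact_mod_cast (show 0 < m' by omega)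
  have hbm : 0 < b * (m' : ℝ) := mul_pos hb hm'pos
  have hx2 : x ^ 2 ≤ 1 / (b * (m' : ℝ)) := by
    rw [le_div_iff₀ hbm]
    rw [hinv] at hlo
    have h0 : 0 ≤ 1 / gIR ^ 2 * x ^ 2 := by positivity
    have h2 := mul_le_mul_of_nonneg_left hlo (pow_pos hxpos 2).le
    rw [mul_one_div, div_self (pow_pos hxpos 2).ne'] at h2
    nlinarith
  have hWγ : 0 ≤ (m' : ℝ) * (W * γ) := mul_nonneg hm'pos.le (mul_nonneg hW hγ.le)
  have hbne : b ≠ 0 := hb.ne'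
  have hmne : (m' : ℝ) ≠ 0 := hm'pos.ne'
  calc (invSq g m' (n' + N) - invSq g m' n') * x ^ 2 ≤ (m' : ℝ) * (W * γ) * (1 / (b * (m' : ℝ))) :=
        mul_le_mul hdiff hx2 (pow_pos hxpos 2).le hWγ
    _ = W * γ / b := by field_simp

/-- **THE LOWER RENEWAL INEQUALITY FOR THE CONTINUUM COUPLING.**  A pinned family of runs of the order-0 profile family (`b > 0`, `γ > 0`, `ρ ≥ 0`,
`Σ_{a<N} ρ(a) ≤ W`, `Wγ < b`; `g K` the run with `K` steps in ]0,γ], `g K K = g_IR`) whose profile is supported on the ages `≤ A`; infrared distance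
`m ≥ A` (and `m ≥ 1`), cutoff `n ≥ A`.  THEN
`Σ_{a≤A} ρ(a)·Σ_{i∈[n−a,n)} ((g (n+m) i)³∕8)·(astar g (n+m−i) − invSq g (n+m−i) i) ≤ (1 + M₁γ³∕(2(1−Wγ∕b)))·(astar g m − invSq g m n)` — the pair
law `disc_ge_windowSum_min` at position `n` of (`g (n+m)`, `g (n+m+N)`) with the `min` resolved by `shiftDisc_mul_sq_le`, then `N → ∞` (finitely many
limits, g47's `continuum_monotone`).  The mirror of the third file's upper contraction: the discrepancy at `(m, n)` is at least the `ρ`-window sum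
of `g³∕8` times the discrepancies one window earlier. [cite: Balaban1987RG1, (0.20) p.256, (0.31) and Thm 2 p.259] -/
theorem astar_sub_invSq_lower_window
    (hβ : ∀ (k : ℕ) (p : Fin (k + 1) → ℝ),
      β k p = b + ∑ i : Fin (k + 1), ρ (k - i) * min (p (Fin.last k)) (|p (Fin.last k) - p i|))
    (hb : 0 < b) (hγ : 0 < γ) (hρ0 : ∀ a, 0 ≤ ρ a) (hρW : ∀ n, ∑ a ∈ range n, ρ a ≤ W) (hsmall : W * γ < b) {A : ℕ}
    (hρA : ∀ a, A < a → ρ a = 0) {g : ℕ → ℕ → ℝ} {gIR : ℝ} (hrun : ∀ K, RGEqH K β (g K))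
    (hbox : ∀ K i, i ≤ K → 0 < g K i ∧ g K i ≤ γ) (hpin : ∀ K, g K K = gIR) {m n : ℕ} (hmA : A ≤ m) (hm1 : 1 ≤ m)
    (hnA : A ≤ n) :
    ∑ a ∈ range (A + 1), ρ a * ∑ i ∈ Ico (n - a) n,
        ((g (n + m) i) ^ 3 / 8 * (astar g (n + m - i) - invSq g (n + m - i) i))
      ≤ (1 + (∑ a ∈ range (A + 1), ρ a * a) * γ ^ 3 / (2 * (1 - W * γ / b))) * (astar g m - invSq g m n) := by
  have hlim := (continuum_monotone hβ hb hγ hρ0 hρW hrun hbox hpin).1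
  -- the pair inequality for every `N`, with the `min` resolved
  have hpair : ∀ N, ∑ a ∈ range (A + 1), ρ a * ∑ i ∈ Ico (n - a) n,
        ((g (n + m) i) ^ 3 / 8 * (invSq g (n + m - i) (i + N) - invSq g (n + m - i) i))
      ≤ (1 + (∑ a ∈ range (A + 1), ρ a * a) * γ ^ 3 / (2 * (1 - W * γ / b))) * (invSq g m (n + N) - invSq g m n) := by
    intro N
    have hA' : RGEqH (n + m) β (g (n + m)) := hrun _
    have hB' : RGEqH (n + m + N) β (g (n + m + N)) := hrun _
    have hpin' : g (n + m) (n + m) = g (n + m + N) (n + m + N) := by rw [hpin, hpin]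
    have h := disc_ge_windowSum_min hβ hb hγ hρ0 hρW hsmall hρA hA' hB' (hbox (n + m)) (fun k hk => (hbox _ k hk).1) hpin'
      (j := n) hnA (by omega)
    have e1 : 1 / (g (n + m + N) (n + N)) ^ 2 - 1 / (g (n + m) n) ^ 2 = invSq g m (n + N) - invSq g m n := by
      rw [invSq_def, invSq_def, show n + N + m = n + m + N by omega]
    rw [e1] at h
    refine le_trans (Finset.sum_le_sum fun a ha => mul_le_mul_of_nonneg_left (Finset.sum_le_sum fun i hi => ?_) (hρ0 a)) h
    -- for `i < n`: `d_i = invSq g (n+m−i) (i+N) − invSq g (n+m−i) i` and `d_i·g_i² ≤ Wγ∕b < 1`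
    have hi2 : i < n := (Finset.mem_Ico.mp hi).2
    set x : ℝ := g (n + m) i with hx
    have hxpos : 0 < x := (hbox _ i (by omega)).1
    have e2 : 1 / (g (n + m + N) (i + N)) ^ 2 - 1 / (g (n + m) i) ^ 2 = invSq g (n + m - i) (i + N) - invSq g (n + m - i) i := by
      rw [invSq_def, invSq_def, show i + N + (n + m - i) = n + m + N by omega, show i + (n + m - i) = n + m by omega]
    rw [e2]
    have hsq := shiftDisc_mul_sq_le hβ hb hρ0 hρW hrun hbox hpin (m' := n + m - i) (by omega) i N
    rw [show i + (n + m - i) = n + m by omega] at hsq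
    have hle1 : (invSq g (n + m - i) (i + N) - invSq g (n + m - i) i) * x ^ 2 ≤ 1 := by
      have : W * γ / b < 1 := (div_lt_one hb).mpr hsmall
      linarith
    rw [min_eq_right hle1]
    have : x / 8 * ((invSq g (n + m - i) (i + N) - invSq g (n + m - i) i) * x ^ 2)
        = x ^ 3 / 8 * (invSq g (n + m - i) (i + N) - invSq g (n + m - i) i) := by ring
    rw [this]
  -- limits: finitely many on the left, one on the right
  have h1 : Tendsto (fun N => ∑ a ∈ range (A + 1), ρ a * ∑ i ∈ Ico (n - a) n,
        ((g (n + m) i) ^ 3 / 8 * (invSq g (n + m - i) (i + N) - invSq g (n + m - i) i))) atTop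
      (𝓝 (∑ a ∈ range (A + 1), ρ a * ∑ i ∈ Ico (n - a) n,
        ((g (n + m) i) ^ 3 / 8 * (astar g (n + m - i) - invSq g (n + m - i) i)))) := by
    refine tendsto_finsetSum _ fun a _ => (tendsto_finsetSum _ fun i hi => ?_).const_mul _
    have hi2 : i < n := (Finset.mem_Ico.mp hi).2
    have ht : Tendsto (fun N => invSq g (n + m - i) (i + N)) atTop (𝓝 (astar g (n + m - i))) :=
      (hlim (n + m - i)).comp (tendsto_atTop_atTop_of_monotone (fun a b hab => by omega) fun N => ⟨N, by omega⟩)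
    exact (ht.sub tendsto_const_nhds).const_mul _
  have h2 : Tendsto (fun N => (1 + (∑ a ∈ range (A + 1), ρ a * a) * γ ^ 3 / (2 * (1 - W * γ / b)))
        * (invSq g m (n + N) - invSq g m n)) atTop
      (𝓝 ((1 + (∑ a ∈ range (A + 1), ρ a * a) * γ ^ 3 / (2 * (1 - W * γ / b))) * (astar g m - invSq g m n))) :=
    (((hlim m).comp (tendsto_atTop_atTop_of_monotone (fun a b hab => by omega) fun N => ⟨N, by omega⟩)).sub
      tendsto_const_nhds).const_mul _
  exact le_of_tendsto_of_tendsto' h1 h2 hpair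

end Summit.QuantumFields.BalabanUV.Beta.RemainderExplicitHistoryDiagonalBoundedMemoryLower
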